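import Literature.NumberTheory.QuadraticFields.FormIdealGenusSublattice
import Literature.NumberTheory.QuadraticFields.IdealClassSumSymmetry
import Literature.NumberTheory.LFunctions.ClassGroupCharacterTwist
import HarnessLib

/-!
# Conrey–Iwaniec (2002), §3 (3.14)–(3.18): the dual side of the `ω`-relation of a class theta
# series — the `L_s`-lattice theta series as a character-weighted class sum over `[𝔰]·[𝔟_A]`

B. Conrey, H. Iwaniec, Acta Arith. 103 (2002) 259–312, §3: under `ω = (a√r, b/√r; c√r, d√r)`,
`s = (c, q)`, the theta series of a class `𝒜` goes to a multiple of the theta series of the class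
`𝒜·[𝔰]` twisted by the genus character `ψ_s` ((3.14)–(3.18); Proposition 2.1 (2.36):
`𝔞* ∼ (r,v)²/(rv)`). In the cell `landau-siegel/ls-inputs` (registered stub V1 `stub_theta_omega`) the
analytic half of this is the tree's class-level relation
`Literature.NumberTheory.Automorphic.binaryTheta_cusp_omega_relation` (two-dimensional Poisson
summation + quadratic Gauss sums), whose dual side is the lattice sum
`Σ_{w ∈ L_s} e(τ·Q̃(w)/s)` over `L_s = {w : s ∣ 2Cw₁ − Bw₂, s ∣ −Bw₁ + 2Aw₂}`, `Q̃ = (C, −B, A)`.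
This file PROVES (theorems only, no definitions, no named facts) the arithmetic identification of
that dual side: with `𝔟_A = (A, ω − k)`, `𝔟_C = (C, ω − k)` (`B = 2k − t`) and the ramified ideal
`𝔰 = (s, ω − k₁)` (`𝔰² = (s)`),

* `dualLatticeSum_eq_one_add_two_mul_classSum` —
  `Σ_{w ∈ L_s} e(τQ̃(w)/s) = 1 + 2·Σ_{𝔞 : 𝔰𝔟_A𝔞 principal, 𝔞 ≠ 0} e(τN𝔞)`: the `L_s`-sum is the
  lattice sum of the ideal `𝔰𝔟_C` (`FormIdealGenusSublattice`), i.e. twice the class sum of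
  `[𝔰𝔟_C]⁻¹ = [𝔰][𝔟_A]`, which is also the class sum over `{𝔞 : 𝔰𝔟_A𝔞 principal}`
  (`IdealClassSumSymmetry`: `(𝔰𝔟_C)(𝔰𝔟_A) = (s)(ω − k)` is principal);
* `dualLatticeSum_eq_one_add_two_mul_twistedClassSum` — the same with a class group character
  `χ` inserted: `= 1 + 2·ν_χ(𝔰)ν_χ(𝔟_A)·Σ_{𝔞 : 𝔰𝔟_A𝔞 principal} ν_χ(𝔞)·[𝔞 ≠ 0]e(τN𝔞)`
  (`ν_χ` is constant `= ν_χ(𝔰𝔟_A)⁻¹` on that class, `ν_χ(𝔰)² = 1`).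

These are the "lattice/class bookkeeping" inputs of the reassembly `Σ_𝒜 ψ(𝒜)·[dual side] =
η·θ(·;ψψ_s)`. «The programme SEARCHES and TYPES; no claim about Landau–Siegel zeros, Theorems 1–2 of
arXiv:2211.02515 or a repaired Margin232 until a kernel theorem says so.»

## References

* [ConreyIwaniec2002] B. Conrey, H. Iwaniec, Acta Arith. 103 (2002) 259–312, §3 (3.14)–(3.18);
  Proposition 2.1 (2.36).
* [Cox2013] D. A. Cox, *Primes of the form x² + ny²*, 2nd ed. (2013), §7.B Thm. 7.7.
-/

noncomputable section

open scoped NumberField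
open Complex Module NumberField Ideal
open Literature.NumberTheory.QuadraticFields.Quadratic

namespace Literature.NumberTheory.LFunctions

namespace ConreyIwaniec2002

open NumberField Literature.NumberTheory.LFunctions.NumberField

variable {K : Type*} [Field K] [NumberField K]

/-! ### The theta weight along a positive definite form -/

/-- The theta weight `f₀(n) = [n ≠ 0]·e(τn)` is absolutely summable along every positive definite
integral form `(A, B, C)` (`summable_cexp_mul_bqf` with the origin removed); private. [folklore] -/
private theorem summable_thetaWeight {A B C : ℤ} (hA : 0 < A) (hdisc : B ^ 2 - 4 * A * C < 0)
    {τ : ℂ} (hτ : 0 < τ.im) :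
    Summable fun p : ℤ × ℤ =>
      (fun n : ℕ => if n = 0 then (0 : ℂ) else cexp (2 * Real.pi * I * τ * (n : ℂ)))
        (A * p.1 ^ 2 + B * p.1 * p.2 + C * p.2 ^ 2).natAbs := by
  classical
  have hpos : Literature.Barriers.RiemannHypothesis.IsPosDefForm (A : ℝ) (B : ℝ) (C : ℝ) :=
    ⟨by exact_mod_cast hA, by exact_mod_cast hdisc⟩
  set g : ℤ × ℤ → ℂ := fun p => cexp (2 * Real.pi * I * τ *
      ((A * p.1 ^ 2 + B * p.1 * p.2 + C * p.2 ^ 2 : ℤ) : ℂ)) with hg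
  have hgsum : Summable g := summable_cexp_mul_bqf hA hdisc hτ
  have hupd : Summable fun p : ℤ × ℤ => if p = 0 then 0 else g p := by
    have : (fun p : ℤ × ℤ => if p = 0 then 0 else g p) = Function.update g 0 0 := by
      funext p; rw [Function.update_apply]
    rw [this]; exact hgsum.update 0 0
  refine hupd.congr fun p => ?_
  by_cases hp : p = 0
  · subst hp; simp
  · have hQ : 0 < Literature.Barriers.RiemannHypothesis.bqfEval (A : ℝ) (B : ℝ) (C : ℝ) p :=
      hpos.eval_pos hp
    have hQeq : Literature.Barriers.RiemannHypothesis.bqfEval (A : ℝ) (B : ℝ) (C : ℝ) p =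
        ((A * p.1 ^ 2 + B * p.1 * p.2 + C * p.2 ^ 2 : ℤ) : ℝ) := by
      unfold Literature.Barriers.RiemannHypothesis.bqfEval; push_cast; ring
    rw [hQeq] at hQ
    have hQ' : 0 < A * p.1 ^ 2 + B * p.1 * p.2 + C * p.2 ^ 2 := by exact_mod_cast hQ
    have hne : (A * p.1 ^ 2 + B * p.1 * p.2 + C * p.2 ^ 2).natAbs ≠ 0 := Int.natAbs_ne_zero.mpr hQ'.ne'
    simp only [hp, if_false, hne, hg]
    congr 2
    rw [← Int.cast_natCast, Int.natAbs_of_nonneg hQ'.le]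

/-! ### The dual lattice sum as a class sum -/

/-- **The `L_s`-lattice theta series is `1 +` twice a class sum**: with `𝔟_A = (A, ω − k)`,
`𝔟_C = (C, ω − k)` a pair of form ideals of the primitive form `(A, B, C)`, `B = 2k − t`, of
discriminant `d_K = t² + 4m < −4` (`A, C > 0`), the ramified ideal `𝔰 = (s, ω − k₁)` (`s` odd,
`s ∣ 2k₁ − t`, `sC₁ = k₁² − tk₁ − m`, `gcd(s, C₁) = 1`) and `Im τ > 0`:
`Σ_{w : s ∣ 2Cw₁ − Bw₂, s ∣ −Bw₁ + 2Aw₂} e(τ·(Cw₁² − Bw₁w₂ + Aw₂²)/s)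
  = 1 + 2·Σ_{𝔞 : 𝔰𝔟_A𝔞 principal} [𝔞 ≠ 0]·e(τN𝔞)`
— the lattice sum IS that of the ideal `𝔰𝔟_C` (`hasSum_ideal_genusSublattice_weight`), the origin
gives `1`, and the class `[𝔰𝔟_C]⁻¹ = [𝔰][𝔟_A]` has the same class sum as its inverse `[𝔰𝔟_A]⁻¹`
(`hasSum_classSum_of_mul_isPrincipal`: `(𝔰𝔟_C)(𝔰𝔟_A) = (s)(ω − k)`). Print: the dual of `θ_𝒜` at
the cusp `a/c`, `(c,q) = s`, is the theta series of `𝒜·[𝔰]` (CI (3.16)–(3.18), Prop. 2.1 (2.36)).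
[cite: ConreyIwaniec2002, §3 (3.16)–(3.18)] [cite: Cox2013, §7.B Thm. 7.7] -/
theorem dualLatticeSum_eq_one_add_two_mul_classSum (b : Basis (Fin 2) ℤ (𝓞 K)) (hb : b 0 = 1)
    {t m : ℤ} (hω : b 1 * b 1 = (m : 𝓞 K) + (t : 𝓞 K) * b 1) (hD : t ^ 2 + 4 * m < -4)
    (h2 : finrank ℚ K = 2) (hd : NumberField.discr K < -4)
    {A B C k : ℤ} (hA : 0 < A) (hC : 0 < C) (hB : B = 2 * k - t)
    (hn : A * C = k ^ 2 - t * k - m) (hprim : ∃ u v w : ℤ, u * A + v * (2 * k - t) + w * C = 1)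
    {s k₁ C₁ : ℤ} (hodd : Odd s) (hs : 0 < s) (hk₁ : s ∣ 2 * k₁ - t)
    (hC₁ : s * C₁ = k₁ ^ 2 - t * k₁ - m) (hcop : IsCoprime s C₁) {τ : ℂ} (hτ : 0 < τ.im) :
    (∑' w : ℤ × ℤ,
        if s ∣ 2 * C * w.1 - B * w.2 ∧ s ∣ -B * w.1 + 2 * A * w.2 then
          cexp (2 * Real.pi * I * τ * (((C * w.1 ^ 2 - B * w.1 * w.2 + A * w.2 ^ 2) / s : ℤ) : ℂ))
        else 0) =
      1 + 2 * ∑' J : {J : Ideal (𝓞 K) //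
          (span {(s : 𝓞 K), b 1 - k₁} * span {(A : 𝓞 K), b 1 - k} * J).IsPrincipal},
        (fun n : ℕ => if n = 0 then (0 : ℂ) else cexp (2 * Real.pi * I * τ * (n : ℂ)))
          (absNorm J.1) := by
  classical
  have hs0 : s ≠ 0 := hs.ne'
  -- the weights
  set f₀ : ℕ → ℂ := fun n => if n = 0 then 0 else cexp (2 * Real.pi * I * τ * (n : ℂ)) with hf₀
  have hf₀0 : f₀ 0 = 0 := by simp [hf₀]
  -- positivity and divisibility of `Q̃ = (C, t − 2k, A)` on `L_s`
  have hdisct : (t - 2 * k) ^ 2 - 4 * C * A < 0 := by nlinarith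
  have hpos : Literature.Barriers.RiemannHypothesis.IsPosDefForm (C : ℝ) ((t - 2 * k : ℤ) : ℝ)
      (A : ℝ) := ⟨by exact_mod_cast hC, by exact_mod_cast hdisct⟩
  have hQpos : ∀ v : ℤ × ℤ, v ≠ 0 → 0 < C * v.1 ^ 2 + (t - 2 * k) * v.1 * v.2 + A * v.2 ^ 2 := by
    intro v hv
    have h1 := hpos.eval_pos hv
    have e : Literature.Barriers.RiemannHypothesis.bqfEval (C : ℝ) ((t - 2 * k : ℤ) : ℝ) (A : ℝ) v =
        ((C * v.1 ^ 2 + (t - 2 * k) * v.1 * v.2 + A * v.2 ^ 2 : ℤ) : ℝ) := by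
      unfold Literature.Barriers.RiemannHypothesis.bqfEval; push_cast; ring
    rw [e] at h1
    exact_mod_cast h1
  have hQnn : ∀ v : ℤ × ℤ, 0 ≤ C * v.1 ^ 2 + (t - 2 * k) * v.1 * v.2 + A * v.2 ^ 2 := by
    intro v
    by_cases hv : v = 0
    · subst hv; simp
    · exact (hQpos v hv).le
  have hdvdQ : ∀ v : ℤ × ℤ, (s ∣ 2 * C * v.1 - (2 * k - t) * v.2 ∧ s ∣ 2 * A * v.2 - (2 * k - t) * v.1) →
      s ∣ C * v.1 ^ 2 + (t - 2 * k) * v.1 * v.2 + A * v.2 ^ 2 := by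
    intro v hv
    have hmem := (mem_genusIdeal_mul_formIdeal_iff b hb hω hodd hk₁ hC₁ hcop hn hC.ne' v.1 v.2).2 hv
    have h1 := Ideal.absNorm_dvd_absNorm_of_le ((Ideal.span_singleton_le_iff_mem _).2 hmem)
    rw [Ideal.absNorm_span_singleton, absNorm_genusIdeal_mul_formIdeal b hb hω hC₁ hn,
      norm_formLattice_elt_swap b hb hω hn, Int.natAbs_mul, mul_comm s.natAbs] at h1
    exact Int.natAbs_dvd_natAbs.mp
      (Nat.dvd_of_mul_dvd_mul_left (Int.natAbs_pos.mpr hC.ne') h1)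
  -- the quotient `Q̃(v)/s` on `L_s`
  have hquot : ∀ v : ℤ × ℤ, (s ∣ 2 * C * v.1 - (2 * k - t) * v.2 ∧ s ∣ 2 * A * v.2 - (2 * k - t) * v.1) →
      ∃ j : ℤ, 0 ≤ j ∧ C * v.1 ^ 2 + (t - 2 * k) * v.1 * v.2 + A * v.2 ^ 2 = s * j ∧
        (C * v.1 ^ 2 + (t - 2 * k) * v.1 * v.2 + A * v.2 ^ 2).natAbs / s.natAbs = j.natAbs := by
    intro v hv
    obtain ⟨j, hj⟩ := hdvdQ v hv
    refine ⟨j, ?_, hj, ?_⟩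
    · have := hQnn v; rw [hj] at this
      exact nonneg_of_mul_nonneg_right this hs
    · rw [hj, Int.natAbs_mul, Nat.mul_div_cancel_left _ (Int.natAbs_pos.mpr hs0)]
  -- (1) the indicator sum as the subtype sum of `[v = 0] + f₀(|Q̃ v| / |s|)`
  have step1 : (∑' w : ℤ × ℤ,
      if s ∣ 2 * C * w.1 - B * w.2 ∧ s ∣ -B * w.1 + 2 * A * w.2 then
        cexp (2 * Real.pi * I * τ * (((C * w.1 ^ 2 - B * w.1 * w.2 + A * w.2 ^ 2) / s : ℤ) : ℂ))
      else 0) =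
      ∑' v : {v : ℤ × ℤ // s ∣ 2 * C * v.1 - (2 * k - t) * v.2 ∧ s ∣ 2 * A * v.2 - (2 * k - t) * v.1},
        ((if v.1 = 0 then (1 : ℂ) else 0) +
          f₀ ((C * v.1.1 ^ 2 + (t - 2 * k) * v.1.1 * v.1.2 + A * v.1.2 ^ 2).natAbs / s.natAbs)) := by
    have hpt : ∀ w : ℤ × ℤ,
        (if s ∣ 2 * C * w.1 - B * w.2 ∧ s ∣ -B * w.1 + 2 * A * w.2 then
          cexp (2 * Real.pi * I * τ * (((C * w.1 ^ 2 - B * w.1 * w.2 + A * w.2 ^ 2) / s : ℤ) : ℂ))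
        else 0) =
        Set.indicator {v : ℤ × ℤ | s ∣ 2 * C * v.1 - (2 * k - t) * v.2 ∧
            s ∣ 2 * A * v.2 - (2 * k - t) * v.1}
          (fun v : ℤ × ℤ => (if v = 0 then (1 : ℂ) else 0) +
            f₀ ((C * v.1 ^ 2 + (t - 2 * k) * v.1 * v.2 + A * v.2 ^ 2).natAbs / s.natAbs)) w := by
      intro w
      have hPiff : (s ∣ 2 * C * w.1 - B * w.2 ∧ s ∣ -B * w.1 + 2 * A * w.2) ↔
          (s ∣ 2 * C * w.1 - (2 * k - t) * w.2 ∧ s ∣ 2 * A * w.2 - (2 * k - t) * w.1) := by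
        rw [hB, show -(2 * k - t) * w.1 + 2 * A * w.2 = 2 * A * w.2 - (2 * k - t) * w.1 by ring]
      by_cases hw : s ∣ 2 * C * w.1 - (2 * k - t) * w.2 ∧ s ∣ 2 * A * w.2 - (2 * k - t) * w.1
      · rw [if_pos (hPiff.2 hw), Set.indicator_of_mem (show w ∈ ({v : ℤ × ℤ |
            s ∣ 2 * C * v.1 - (2 * k - t) * v.2 ∧ s ∣ 2 * A * v.2 - (2 * k - t) * v.1} :
            Set (ℤ × ℤ)) from hw)]
        obtain ⟨j, hj0, hj, hjq⟩ := hquot w hw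
        have hq : (C * w.1 ^ 2 - B * w.1 * w.2 + A * w.2 ^ 2) = s * j := by rw [hB, ← hj]; ring
        rw [hq, hjq, Int.mul_ediv_cancel_left _ hs0]
        by_cases hw0 : w = 0
        · subst hw0
          have hj' : j = 0 := by simpa [hs0] using hj
          subst hj'
          simp [hf₀]
        · have hjpos : 0 < j := by
            have := hQpos w hw0; rw [hj] at this
            exact pos_of_mul_pos_right this hs.le
          have hjne : j.natAbs ≠ 0 := Int.natAbs_ne_zero.mpr hjpos.ne'
          rw [if_neg hw0, zero_add]
          simp only [hf₀, hjne, if_false]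
          congr 2
          rw [Nat.cast_natAbs, abs_of_nonneg hj0]
      · rw [if_neg (fun h => hw (hPiff.1 h)),
          Set.indicator_of_notMem (show w ∉ ({v : ℤ × ℤ |
            s ∣ 2 * C * v.1 - (2 * k - t) * v.2 ∧ s ∣ 2 * A * v.2 - (2 * k - t) * v.1} :
            Set (ℤ × ℤ)) from hw)]
    calc _ = ∑' w : ℤ × ℤ, Set.indicator {v : ℤ × ℤ | s ∣ 2 * C * v.1 - (2 * k - t) * v.2 ∧
            s ∣ 2 * A * v.2 - (2 * k - t) * v.1}
          (fun v : ℤ × ℤ => (if v = 0 then (1 : ℂ) else 0) +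
            f₀ ((C * v.1 ^ 2 + (t - 2 * k) * v.1 * v.2 + A * v.2 ^ 2).natAbs / s.natAbs)) w :=
          tsum_congr hpt
      _ = _ := (tsum_subtype {v : ℤ × ℤ | s ∣ 2 * C * v.1 - (2 * k - t) * v.2 ∧
            s ∣ 2 * A * v.2 - (2 * k - t) * v.1}
          (fun v : ℤ × ℤ => (if v = 0 then (1 : ℂ) else 0) +
            f₀ ((C * v.1 ^ 2 + (t - 2 * k) * v.1 * v.2 + A * v.2 ^ 2).natAbs / s.natAbs))).symm
      _ = _ := rfl
  -- (2) summability of the `f₀`-part along `L_s` (restriction of the theta weight of `Q̃`)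
  have hsumf : Summable fun v : {v : ℤ × ℤ // s ∣ 2 * C * v.1 - (2 * k - t) * v.2 ∧
      s ∣ 2 * A * v.2 - (2 * k - t) * v.1} =>
      f₀ ((C * v.1.1 ^ 2 + (t - 2 * k) * v.1.1 * v.1.2 + A * v.1.2 ^ 2).natAbs / s.natAbs) := by
    have hsR : ((s : ℤ) : ℂ) = ((s : ℝ) : ℂ) := by norm_cast
    have hτ' : 0 < (τ / (s : ℝ)).im := by
      rw [Complex.div_ofReal_im]; exact div_pos hτ (by exact_mod_cast hs)
    have h1 := (summable_thetaWeight hC hdisct hτ').subtype fun v : ℤ × ℤ =>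
      s ∣ 2 * C * v.1 - (2 * k - t) * v.2 ∧ s ∣ 2 * A * v.2 - (2 * k - t) * v.1
    refine h1.congr fun v => ?_
    simp only [Function.comp_apply]
    obtain ⟨j, hj0, hj, hjq⟩ := hquot v.1 v.2
    rw [hjq, hj, Int.natAbs_mul]
    by_cases hj00 : j = 0
    · subst hj00; simp [hf₀]
    · have hjne : j.natAbs ≠ 0 := Int.natAbs_ne_zero.mpr hj00
      have hsj : s.natAbs * j.natAbs ≠ 0 := mul_ne_zero (Int.natAbs_ne_zero.mpr hs0) hjne
      simp only [hf₀, hjne, hsj, if_false]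
      congr 1
      have hsC : ((s : ℝ) : ℂ) ≠ 0 := by exact_mod_cast hs0
      have es : ((s.natAbs : ℕ) : ℂ) = ((s : ℝ) : ℂ) := by
        rw [Nat.cast_natAbs, abs_of_pos hs]; norm_cast
      have ej : ((j.natAbs : ℕ) : ℂ) = ((j : ℤ) : ℂ) := by
        rw [Nat.cast_natAbs, abs_of_nonneg hj0]
      rw [Nat.cast_mul, es, ej]
      field_simp
  have hsum1 : Summable fun v : {v : ℤ × ℤ // s ∣ 2 * C * v.1 - (2 * k - t) * v.2 ∧
      s ∣ 2 * A * v.2 - (2 * k - t) * v.1} => (if v.1 = 0 then (1 : ℂ) else 0) := by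
    refine summable_of_ne_finset_zero (s := {⟨0, by simp⟩}) fun v hv => ?_
    rw [Finset.mem_singleton] at hv
    exact if_neg fun h => hv (Subtype.ext h)
  have htsum1 : (∑' v : {v : ℤ × ℤ // s ∣ 2 * C * v.1 - (2 * k - t) * v.2 ∧
      s ∣ 2 * A * v.2 - (2 * k - t) * v.1}, (if v.1 = 0 then (1 : ℂ) else 0)) = 1 := by
    rw [tsum_eq_single ⟨0, by simp⟩ fun v hv => if_neg fun h => hv (Subtype.ext h)]
    simp
  -- (3) the class sum of `[𝔰𝔟_C]⁻¹`, then of `[𝔰𝔟_A]⁻¹`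
  have step3 := hasSum_ideal_genusSublattice_weight b hb hω h2 hd hodd hk₁ hC₁ hcop hn hC.ne'
    hf₀0 hsumf
  have h𝔰0 : span {(s : 𝓞 K), b 1 - k₁} ≠ ⊥ := fun h0 => hs0 (intCast_eq_zero_of_basis b hb (by
    have hmem : (s : 𝓞 K) ∈ span {(s : 𝓞 K), b 1 - k₁} := Ideal.subset_span (by simp)
    rw [h0] at hmem; simpa using hmem))
  have h𝔟A0 : span {(A : 𝓞 K), b 1 - k} ≠ ⊥ := fun h0 => hA.ne' (intCast_eq_zero_of_basis b hb (by
    have hmem : (A : 𝓞 K) ∈ span {(A : 𝓞 K), b 1 - k} := Ideal.subset_span (by simp)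
    rw [h0] at hmem; simpa using hmem))
  have h𝔟C0 : span {(C : 𝓞 K), b 1 - k} ≠ ⊥ := fun h0 => hC.ne' (intCast_eq_zero_of_basis b hb (by
    have hmem : (C : 𝓞 K) ∈ span {(C : 𝓞 K), b 1 - k} := Ideal.subset_span (by simp)
    rw [h0] at hmem; simpa using hmem))
  have hcc : (span {(s : 𝓞 K), b 1 - k₁} * span {(C : 𝓞 K), b 1 - k} *
      (span {(s : 𝓞 K), b 1 - k₁} * span {(A : 𝓞 K), b 1 - k})).IsPrincipal := by
    have e : span {(s : 𝓞 K), b 1 - k₁} * span {(C : 𝓞 K), b 1 - k} *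
        (span {(s : 𝓞 K), b 1 - k₁} * span {(A : 𝓞 K), b 1 - k}) =
        (span {(s : 𝓞 K), b 1 - k₁} * span {(s : 𝓞 K), b 1 - k₁}) *
          (span {(A : 𝓞 K), b 1 - k} * span {(C : 𝓞 K), b 1 - k}) := by ring
    rw [e, genusIdeal_mul_self b hω hk₁ hC₁ hcop, formIdeal_mul_formIdeal_swap b hω hn hprim,
      Ideal.span_singleton_mul_span_singleton]
    exact ⟨⟨_, rfl⟩⟩
  have hneg : t ^ 2 + 4 * m < 0 := by linarith
  have step4 := hasSum_classSum_of_mul_isPrincipal b hb hω hD (mul_ne_zero h𝔰0 h𝔟C0)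
    (mul_ne_zero h𝔰0 h𝔟A0) hcc hf₀0 (fun A' B' C' hA' hdisc' =>
      summable_thetaWeight hA' (by rw [hdisc']; exact hneg) hτ) step3
  -- assemble
  rw [step1, (hsum1.hasSum.add hsumf.hasSum).tsum_eq, htsum1, step4.tsum_eq]
  ring

/-- `ν_χ(𝔞) = 1` for a nonzero principal ideal; private. [folklore] -/
private theorem classGroupCharIdealHom_of_isPrincipal' (χ : ClassGroup (𝓞 K) →* ℂˣ)
    {I : Ideal (𝓞 K)} (hI : I ≠ ⊥) (hP : I.IsPrincipal) : classGroupCharIdealHom χ I = 1 := by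
  rw [classGroupCharIdealHom_apply_of_ne_bot χ hI,
    (ClassGroup.mk0_eq_one_iff (mem_nonZeroDivisors_of_ne_zero hI)).mpr hP, map_one, Units.val_one]

/-- **The dual `L_s`-lattice theta series as a character-weighted class sum**: in the setting of
`dualLatticeSum_eq_one_add_two_mul_classSum`, for every class group character `χ`,
`Σ_{w ∈ L_s} e(τQ̃(w)/s) = 1 + 2·ν_χ(𝔰)·ν_χ(𝔟_A)·Σ_{𝔞 : 𝔰𝔟_A𝔞 principal} ν_χ(𝔞)·[𝔞 ≠ 0]e(τN𝔞)`
(`ν_χ(𝔰)ν_χ(𝔟_A)ν_χ(𝔞) = ν_χ(𝔰𝔟_A𝔞) = 1` on that class). This is the form in which the dual sides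
are reassembled over `Cl(K)` against `Σ_n λ_χ(n)e(nτ)` (CI (3.14)/(3.17): the twist by the genus
character `ψ_s` enters through `ν_χ(𝔰) = ±1`). [cite: ConreyIwaniec2002, §3 (3.16)–(3.18)] -/
theorem dualLatticeSum_eq_one_add_two_mul_twistedClassSum (b : Basis (Fin 2) ℤ (𝓞 K))
    (hb : b 0 = 1) {t m : ℤ} (hω : b 1 * b 1 = (m : 𝓞 K) + (t : 𝓞 K) * b 1)
    (hD : t ^ 2 + 4 * m < -4) (h2 : finrank ℚ K = 2) (hd : NumberField.discr K < -4)
    {A B C k : ℤ} (hA : 0 < A) (hC : 0 < C) (hB : B = 2 * k - t)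
    (hn : A * C = k ^ 2 - t * k - m) (hprim : ∃ u v w : ℤ, u * A + v * (2 * k - t) + w * C = 1)
    {s k₁ C₁ : ℤ} (hodd : Odd s) (hs : 0 < s) (hk₁ : s ∣ 2 * k₁ - t)
    (hC₁ : s * C₁ = k₁ ^ 2 - t * k₁ - m) (hcop : IsCoprime s C₁) {τ : ℂ} (hτ : 0 < τ.im)
    (χ : ClassGroup (𝓞 K) →* ℂˣ) :
    (∑' w : ℤ × ℤ,
        if s ∣ 2 * C * w.1 - B * w.2 ∧ s ∣ -B * w.1 + 2 * A * w.2 then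
          cexp (2 * Real.pi * I * τ * (((C * w.1 ^ 2 - B * w.1 * w.2 + A * w.2 ^ 2) / s : ℤ) : ℂ))
        else 0) =
      1 + 2 * (classGroupCharIdealHom χ (span {(s : 𝓞 K), b 1 - k₁}) *
          classGroupCharIdealHom χ (span {(A : 𝓞 K), b 1 - k})) *
        ∑' J : {J : Ideal (𝓞 K) //
          (span {(s : 𝓞 K), b 1 - k₁} * span {(A : 𝓞 K), b 1 - k} * J).IsPrincipal},
          classGroupCharIdealHom χ J.1 *
            (fun n : ℕ => if n = 0 then (0 : ℂ) else cexp (2 * Real.pi * I * τ * (n : ℂ)))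
              (absNorm J.1) := by
  classical
  have key : ∀ J : {J : Ideal (𝓞 K) //
      (span {(s : 𝓞 K), b 1 - k₁} * span {(A : 𝓞 K), b 1 - k} * J).IsPrincipal},
      (classGroupCharIdealHom χ (span {(s : 𝓞 K), b 1 - k₁}) *
          classGroupCharIdealHom χ (span {(A : 𝓞 K), b 1 - k})) *
        (classGroupCharIdealHom χ J.1 *
          (fun n : ℕ => if n = 0 then (0 : ℂ) else cexp (2 * Real.pi * I * τ * (n : ℂ)))
            (absNorm J.1)) =
      (fun n : ℕ => if n = 0 then (0 : ℂ) else cexp (2 * Real.pi * I * τ * (n : ℂ)))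
        (absNorm J.1) := by
    intro J
    by_cases hJ : J.1 = ⊥
    · simp only [hJ, Ideal.absNorm_bot, if_true, mul_zero]
    · have hne : span {(s : 𝓞 K), b 1 - k₁} * span {(A : 𝓞 K), b 1 - k} * J.1 ≠ ⊥ := by
        intro h0
        rw [Ideal.mul_eq_bot] at h0
        rcases h0 with h0 | h0
        · rw [Ideal.mul_eq_bot] at h0
          rcases h0 with h0 | h0
          · have hmem : (s : 𝓞 K) ∈ span {(s : 𝓞 K), b 1 - k₁} := Ideal.subset_span (by simp)
            rw [h0] at hmem
            exact hs.ne' (intCast_eq_zero_of_basis b hb (by simpa using hmem))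
          · have hmem : (A : 𝓞 K) ∈ span {(A : 𝓞 K), b 1 - k} := Ideal.subset_span (by simp)
            rw [h0] at hmem
            exact hA.ne' (intCast_eq_zero_of_basis b hb (by simpa using hmem))
        · exact hJ h0
      have h1 := classGroupCharIdealHom_of_isPrincipal' χ hne J.2
      rw [map_mul, map_mul] at h1
      rw [← mul_assoc, h1, one_mul]
  have hS : (∑' J : {J : Ideal (𝓞 K) //
      (span {(s : 𝓞 K), b 1 - k₁} * span {(A : 𝓞 K), b 1 - k} * J).IsPrincipal},
      (fun n : ℕ => if n = 0 then (0 : ℂ) else cexp (2 * Real.pi * I * τ * (n : ℂ)))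
        (absNorm J.1)) =
      (classGroupCharIdealHom χ (span {(s : 𝓞 K), b 1 - k₁}) *
          classGroupCharIdealHom χ (span {(A : 𝓞 K), b 1 - k})) *
        ∑' J : {J : Ideal (𝓞 K) //
          (span {(s : 𝓞 K), b 1 - k₁} * span {(A : 𝓞 K), b 1 - k} * J).IsPrincipal},
          classGroupCharIdealHom χ J.1 *
            (fun n : ℕ => if n = 0 then (0 : ℂ) else cexp (2 * Real.pi * I * τ * (n : ℂ)))
              (absNorm J.1) := by
    rw [← tsum_mul_left]
    exact (tsum_congr key).symm
  rw [dualLatticeSum_eq_one_add_two_mul_classSum b hb hω hD h2 hd hA hC hB hn hprim hodd hs hk₁ hC₁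
    hcop hτ, hS, ← mul_assoc]

end ConreyIwaniec2002

end Literature.NumberTheory.LFunctions

end
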